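import Literature.NumberTheory.Transcendental.KZNoriSymbol
import Literature.NumberTheory.Transcendental.KZCalculusProofs
import Literature.AlgebraicGeometry.Motives.HodgeColevelFiltrationSymbols
import Literature.AlgebraicGeometry.Motives.MixedHodgeStructureOfPair
import Summits.KontsevichZagierPeriods.KontsevichZagierPeriods.Theorems.DegreeEquality.Negative.ZeroLayer
import HarnessLib

/-!
# `DegreeEquality` (stmt-KontsevichZagierPeriods-6960, route HodgeColevel, informal crux r7) —
# negative side, second instalment: the announced TYPED READING is false at the zero edge, and
# is junk-false for unconstrained Hodge data

Refuter crux-attack evidence (gen 2; classify, do not prove). Since the first instalment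
(`ZeroLayer.lean`) all three definition requests of the crux exist in the tree:
D1 `KZ.degree` (`KZDegree.lean`), D2 the Nori symbol as the HYPOTHESIS structure
`KZ.NoriSymbolData R B σ` with `KZ.noriSymbol Ψ : KZ.FormalRep →+ EffectiveFormalPeriods R B σ`
(`KZNoriSymbol.lean`), and D3 `HodgePeriodDatum.hodgeColevel : P → WithBot (WithTop ℤ)`
(`HodgeColevelFiltration.lean`, instance `HodgePeriodDatum.ofSymbols` on the same space
`EffectiveFormalPeriods R B σ = FreePeriodSymbols R σ ⧸ formalPeriodRelations R B σ`).
The work item announces the typed reading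

  `∀ n (r : IntegralRep n), KZ.degree r = hodgeColevel (noriSymbol (of r))`.

Two cheap facts about THAT reading, for every period datum `(R, B, σ)`, every symbol data `Ψ`
and every Hodge period datum `D` on `𝒫̃⁺` (in particular every `ofSymbols R B σ M`):

* §1 **Zero edge.** D3 puts `hodgeColevel 0 = ⊥` (`HodgePeriodDatum.hodgeColevel_zero`: `0`
  lies in every step `C_c`, `c ∈ ℤ`), whereas a degree is a natural number. Every NULL
  representation (`[r] ∈ KZ.relations`, e.g. the empty representation `IntegralRep.empty n`, or
  `∫₀¹ (2x - 1) dx`) has `Ψ[r] = 0` and `KZ.degree r = 0`, so the reading, with either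
  available coercion of the degree into `WithBot (WithTop ℤ)` (through `ℤ`, or `Nat.cast`), FAILS
  at it (`coe_degree_ne_hodgeColevel_of_noriSymbol_eq_zero`, `not_typedReading`,
  `not_typedReading'`). The informal text
  ("least k with x ∈ C_k", `k ∈ ℕ`) meant `L(0) = 0`; the delivered D3 does not. Minimal repair
  (planner): state the equality OFF the zero symbol,
  `∀ r, noriSymbol Ψ (of r) ≠ 0 → ((degree r : ℤ) : WithBot (WithTop ℤ)) = D.hodgeColevel (Ψ r)`,
  and keep the zero-symbol layer `Ψ r = 0 → degree r = 0` separate — it is EXACTLY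
  `Ψ.IsFaithful` (`zeroSymbolLayer_iff_isFaithful`, first instalment). The empty witness does
  not bite the repaired reading (`repairedReading_holds_at_null`).
* §2 **Junk Hodge data.** `ofSymbols R B σ M` takes the Hodge realisations `M` of the vertices
  `Hⁱ(X, D)` as a free parameter on free carriers. If the data put every vertex into every step
  (`∀ i c, (D.hodge i).HodgeTypesLE c` — true for the zero mixed Hodge structure on zero
  carriers) and the coefficient spaces exhaust `𝒫̃⁺` (always: `iSup_coeff_ofSymbols`), then
  `C_c = ⊤` for all `c` and `hodgeColevel ≡ ⊥` (`hodgeColevel_eq_bot_of_forall_hodgeTypesLE`),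
  so even the REPAIRED reading fails at every representation of non-zero value
  (`not_repairedReading_of_forall_hodgeTypesLE`; a `0`-dimensional constant `1` exists,
  `exists_noriSymbol_of_ne_zero`). Hence a `∀ M`-reading of `DegreeEquality` is false for the
  wrong reason: `M` must be bound to Deligne's structure (`MixedHodgeStructureOfPair`, with the
  type box `[0, i]²`, Hodge III 8.2.4 / 8.3.9) or existentially quantified.
* §3 **With pair-bound Hodge data the lower bound is free.** For `𝓜 : MixedHodgeStructureOfPair k`
  the datum `ofSymbols R B σ 𝓜.mhs` typechecks verbatim, every vertex `Hⁿ(X, D)` has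
  `HodgeTypesLE n` (`hodgeTypesLE_mhs`, from the box), and the `DegreeBound` half
  `hodgeColevel Ψ[r] ≤ KZ.degree r` holds for EVERY period datum and EVERY `Ψ`
  (`hodgeColevel_noriSymbol_le_degree`, from (Ψ3) at the degree): in the delivered VERTEX-indexed
  D3 the repaired typed `DegreeEquality` is equivalent to its upper-bound half
  (`repairedReading_iff_upperBound`) — cohomological-degree effectivity plus accessibility; the
  Hodge TYPES (strictness, Jordan–Hölder) only enter the non-membership statements
  `Ψ[r] ∉ C_{c-1}` of the `DegreeBound` instances, not this crux.

Nothing here refutes the INTENDED statement (deg_KZ = Hodge co-level off the zero symbol, for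
the classical datum, a motivic `Ψ` and Deligne's `M`); the item carries no Lean signature.

Sources: M. Kontsevich, D. Zagier, *Periods* (2001), §1.2 Problem 2; A. Huber, S. Müller-Stach,
*Periods and Nori Motives* (2017), Def. 13.1.1, §13.1–13.2; P. Deligne, *Théorie de Hodge III*
(1974), 8.2.4, 8.3.9.
-/

noncomputable section

open MeasureTheory Set
open Literature.NumberTheory.Transcendental Literature.NumberTheory.Transcendental.KZ
open Literature.AlgebraicGeometry.Motives

namespace Summit.KontsevichZagierPeriods.Theorems.DegreeEquality.Negative

universe u v

variable {n : ℕ}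
variable {k : Type} [Field k] [CharZero k]
  {P : Literature.AlgebraicGeometry.Motives.PeriodRealization k}
  {R : Literature.AlgebraicGeometry.Motives.RelativePeriodData P} {B : R.BoundaryData}
  {σ : k →+* ℂ}
  {ι : Type u} {V : ι → Type v} [∀ i, AddCommGroup (V i)] [∀ i, Module ℚ (V i)]

/-! ## §1 The zero edge of the announced typed reading -/

/-- The Nori symbol of the empty representation vanishes (`[∅] ∈ relations`, Ψ2). [folklore] -/
theorem noriSymbol_of_empty (Ψ : NoriSymbolData R B σ) (n : ℕ) :
    noriSymbol Ψ (of (IntegralRep.empty n)) = 0 :=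
  noriSymbol_eq_zero_of_mem_relations Ψ IntegralRep.of_empty_mem_relations

/-- The empty representation has KZ-degree `0`. [folklore] -/
theorem degree_empty (n : ℕ) : degree (IntegralRep.empty n) = 0 :=
  degree_eq_zero_of_of_mem_relations IntegralRep.of_empty_mem_relations

/-- A coerced natural number is never `⊥` in `ℤ ∪ {±∞}`. [folklore] -/
theorem coe_coe_natCast_ne_bot (d : ℕ) :
    (((d : ℤ) : WithTop ℤ) : WithBot (WithTop ℤ)) ≠ ⊥ :=
  WithBot.coe_ne_bot

/-- **Zero edge.** At every representation whose Nori symbol vanishes (every null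
representation; e.g. the empty one), the announced typed reading `degree r = hodgeColevel Ψ[r]`
fails for EVERY Hodge period datum on `𝒫̃⁺`: the left side is a natural number, the right side
is `hodgeColevel 0 = ⊥`. [folklore] -/
theorem coe_degree_ne_hodgeColevel_of_noriSymbol_eq_zero (Ψ : NoriSymbolData R B σ)
    (D : HodgePeriodDatum k (EffectiveFormalPeriods R B σ) ι V) {r : IntegralRep n}
    (h : noriSymbol Ψ (of r) = 0) :
    (((degree r : ℤ) : WithTop ℤ) : WithBot (WithTop ℤ)) ≠ D.hodgeColevel (noriSymbol Ψ (of r)) := by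
  rw [h, HodgePeriodDatum.hodgeColevel_zero]
  exact coe_coe_natCast_ne_bot _

/-- **The announced typed reading of `DegreeEquality` is false as it stands**, for every period
datum, every Nori symbol data `Ψ` and every Hodge period datum `D` on the effective formal
periods (witness: the empty representation in dimension `0`). This is a statement about the
TYPING (the `WithBot` zero convention of D3), not about the intended conjecture. [folklore] -/
theorem not_typedReading (Ψ : NoriSymbolData R B σ)
    (D : HodgePeriodDatum k (EffectiveFormalPeriods R B σ) ι V) :
    ¬ ∀ ⦃n : ℕ⦄ (r : IntegralRep n),
        (((degree r : ℤ) : WithTop ℤ) : WithBot (WithTop ℤ)) = D.hodgeColevel (noriSymbol Ψ (of r)) :=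
  fun h => coe_degree_ne_hodgeColevel_of_noriSymbol_eq_zero Ψ D (noriSymbol_of_empty Ψ 0)
    (h (IntegralRep.empty 0))

/-- The same, with the degree cast directly along `ℕ → WithBot (WithTop ℤ)` (the other spelling
of the announced reading). [folklore] -/
theorem not_typedReading' (Ψ : NoriSymbolData R B σ)
    (D : HodgePeriodDatum k (EffectiveFormalPeriods R B σ) ι V) :
    ¬ ∀ ⦃n : ℕ⦄ (r : IntegralRep n),
        (degree r : WithBot (WithTop ℤ)) = D.hodgeColevel (noriSymbol Ψ (of r)) := by
  intro h
  have h0 := h (IntegralRep.empty 0)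
  rw [noriSymbol_of_empty, HodgePeriodDatum.hodgeColevel_zero] at h0
  exact WithBot.natCast_ne_bot _ h0

/-- The repaired reading (equality only OFF the zero symbol) is not bitten by null witnesses:
at a representation with vanishing symbol its hypothesis is void, and the separate zero-symbol
clause `degree r = 0` holds for null representations. [folklore] -/
theorem repairedReading_holds_at_null (Ψ : NoriSymbolData R B σ)
    (D : HodgePeriodDatum k (EffectiveFormalPeriods R B σ) ι V) {r : IntegralRep n}
    (hr : of r ∈ relations) :
    (noriSymbol Ψ (of r) ≠ 0 →
        (((degree r : ℤ) : WithTop ℤ) : WithBot (WithTop ℤ)) = D.hodgeColevel (noriSymbol Ψ (of r))) ∧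
      degree r = 0 :=
  ⟨fun h => (h (noriSymbol_eq_zero_of_mem_relations Ψ hr)).elim,
    degree_eq_zero_of_of_mem_relations hr⟩

/-! ## §2 Junk Hodge data make the co-level identically `⊥` -/

omit [CharZero k] in
/-- If every object of a Hodge period datum has all Hodge types `≤ c`, the step `C_c` is the span
of all coefficient spaces. [folklore] -/
theorem hodgeColevelFiltration_eq_iSup_of_forall_hodgeTypesLE
    {P' : Type*} [AddCommGroup P'] [Module k P'] (D : HodgePeriodDatum k P' ι V) {c : ℤ}
    (hD : ∀ i, (D.hodge i).HodgeTypesLE c) : D.hodgeColevelFiltration c = ⨆ i, D.coeff i :=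
  le_antisymm (D.hodgeColevelFiltration_le_iSup_coeff c)
    (iSup_le fun i => D.coeff_le_hodgeColevelFiltration (hD i))

omit [CharZero k] in
/-- **Junk Hodge data.** If every object lies in every step (`HodgeTypesLE c` for all `c`, as for
the zero mixed Hodge structure on zero carriers) and the coefficient spaces exhaust the space of
formal periods (as they do on `𝒫̃⁺`, `iSup_coeff_ofSymbols`), then EVERY formal period has Hodge
co-level `⊥`. [folklore] -/
theorem hodgeColevel_eq_bot_of_forall_hodgeTypesLE
    {P' : Type*} [AddCommGroup P'] [Module k P'] (D : HodgePeriodDatum k P' ι V)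
    (hD : ∀ i (c : ℤ), (D.hodge i).HodgeTypesLE c) (htop : ⨆ i, D.coeff i = ⊤) (x : P') :
    D.hodgeColevel x = ⊥ := by
  refine HodgePeriodDatum.hodgeColevel_eq_bot_iff.2 fun c => ?_
  rw [hodgeColevelFiltration_eq_iSup_of_forall_hodgeTypesLE D fun i => hD i c, htop]
  trivial

/-- There is a representation with non-zero Nori symbol: the `0`-dimensional constant `1`
(value `1 ≠ 0`, and `Ψ[r] = 0 ⇒ value r = 0` by Ψ1). [folklore] -/
theorem exists_noriSymbol_of_ne_zero (Ψ : NoriSymbolData R B σ) :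
    ∃ p : IntegralRep 0, noriSymbol Ψ (of p) ≠ 0 := by
  let p : IntegralRep 0 :=
    { domain := univ
      integrand := fun _ => 1
      isSemialgebraic_domain := Literature.ModelTheory.ExponentialFields.isSemialgebraic_univ
      isSemialgebraicFunOn_integrand :=
        (isSemialgebraicFunOn_aeval Literature.ModelTheory.ExponentialFields.isSemialgebraic_univ 1).congr
          fun _ _ => by simp
      integrableOn := by
        refine (integrableOn_const_iff).2 (Or.inr ?_)
        exact measure_lt_top _ _ }
  refine ⟨p, fun h => ?_⟩
  have hval : p.value = 1 := by
    rw [value_eq_of_dim_zero p ⟨default, mem_univ _⟩]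
  have h0 := value_eq_zero_of_noriSymbol_eq_zero Ψ h
  rw [hval] at h0
  exact one_ne_zero h0

/-- **Even the repaired reading is junk-false for unconstrained Hodge data**: if the Hodge data
put every vertex into every step and the coefficient spaces exhaust `𝒫̃⁺`, then
`degree r ≤ hodgeColevel Ψ[r]` fails at every representation with non-zero symbol (the co-level
is `⊥`). So a reading quantifying universally over the Hodge realisations `M` of
`HodgePeriodDatum.ofSymbols R B σ M` is false for the wrong reason; `M` must be tied to Deligne's
mixed Hodge structure of the pair (type box `[0, i]²`). [folklore] -/
theorem not_repairedReading_of_forall_hodgeTypesLE (Ψ : NoriSymbolData R B σ)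
    (D : HodgePeriodDatum k (EffectiveFormalPeriods R B σ) ι V)
    (hD : ∀ i (c : ℤ), (D.hodge i).HodgeTypesLE c) (htop : ⨆ i, D.coeff i = ⊤) :
    ¬ ∀ ⦃n : ℕ⦄ (r : IntegralRep n), noriSymbol Ψ (of r) ≠ 0 →
        (((degree r : ℤ) : WithTop ℤ) : WithBot (WithTop ℤ)) ≤ D.hodgeColevel (noriSymbol Ψ (of r)) := by
  intro h
  obtain ⟨p, hp⟩ := exists_noriSymbol_of_ne_zero Ψ
  have := h p hp
  rw [hodgeColevel_eq_bot_of_forall_hodgeTypesLE D hD htop, le_bot_iff] at this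
  exact coe_coe_natCast_ne_bot _ this

/-! ## §3 With the Hodge data bound to the axioms of a pair, the `DegreeBound` half is free

For `𝓜 : MixedHodgeStructureOfPair k` (Deligne's axioms, in particular the type box `[0, i]²` of
`Hⁱ(X, D)`, Hodge III 8.2.4 / 8.3.9) the Hodge period datum `ofSymbols R B σ 𝓜.mhs` typechecks
verbatim, and the LOWER bound `hodgeColevel Ψ[r] ≤ KZ.degree r` of the repaired reading holds for
every period datum and every symbol data `Ψ`, from (Ψ3) at the degree
(`KZ.exists_noriSymbol_of_mem_coefficientSpace_degree`) and the box alone: in the VERTEX-indexed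
D3 the content of the typed `DegreeEquality` is entirely the upper bound
`KZ.degree r ≤ hodgeColevel Ψ[r]` (effectivity + accessibility), and the non-trivial instances
of `DegreeBound` (`PiPowDegree`, …) are non-membership statements `Ψ[r] ∉ C_{c-1}` needing
strictness, not this inequality. -/

section PairHodgeData

variable [Algebra k ℂ]

omit [CharZero k] in
/-- Deligne's type box makes every vertex `Hⁿ(X, D)` of a pair of varieties satisfy
`HodgeTypesLE n`. [cite: DeligneHodgeIII1974, Thm. 8.2.4 and 8.3.9] -/
theorem hodgeTypesLE_mhs (𝓜 : MixedHodgeStructureOfPair k) {Y : SchemePair k}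
    (hY : Y.IsVarietyPair) (n : ℕ) : (𝓜.mhs Y n).HodgeTypesLE n := by
  intro p q hpq
  by_contra hmax
  exact hpq (𝓜.piece_eq_bot_of_not_mem_box hY n p q fun h => hmax (max_le h.2.1 h.2.2.2))

omit [Algebra k ℂ] in
/-- The coefficient space of a pair in degree `i` (`KZNoriSymbol.coefficientSpace`) is contained
in (indeed equal to) the coefficient space of the vertex `(Y, i)` of `ofSymbols`. [folklore] -/
theorem coefficientSpace_le_coeff_ofSymbols
    {V' : SchemePair k → ℕ → Type v} [∀ Y i, AddCommGroup (V' Y i)] [∀ Y i, Module ℚ (V' Y i)]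
    (M : ∀ (Y : SchemePair k) (i : ℕ), MixedHodgeStructure (V' Y i))
    (Y : SchemePair k) (hY : Y.IsVarietyPair) (i : ℕ) :
    coefficientSpace R B σ Y hY i ≤ (HodgePeriodDatum.ofSymbols R B σ M).coeff (PairsVertex.mk Y hY i) := by
  rw [coefficientSpace, Submodule.map_le_iff_le_comap, pairSymbolSpan, Submodule.span_le]
  rintro _ ⟨ωγ, rfl⟩
  exact HodgePeriodDatum.mkQ_periodSymbol_mem_coeff M Y hY i ωγ.1 ωγ.2

/-- **`DegreeBound`, typed vertex form, holds for free**: for every period datum, every symbol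
data `Ψ` and every Hodge datum of pairs `𝓜` satisfying Deligne's axioms,
`hodgeColevel Ψ[r] ≤ KZ.degree r`. [folklore] -/
theorem hodgeColevel_noriSymbol_le_degree (Ψ : NoriSymbolData R B σ)
    (𝓜 : MixedHodgeStructureOfPair k) (r : IntegralRep n) :
    (HodgePeriodDatum.ofSymbols R B σ 𝓜.mhs).hodgeColevel (noriSymbol Ψ (of r)) ≤
      ((degree r : ℤ) : WithTop ℤ) := by
  obtain ⟨Y, hY, -, -, hmem⟩ := exists_noriSymbol_of_mem_coefficientSpace_degree Ψ r
  exact (HodgePeriodDatum.ofSymbols R B σ 𝓜.mhs).hodgeColevel_le_of_mem_coeff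
    (i := PairsVertex.mk Y hY (degree r)) (hodgeTypesLE_mhs 𝓜 hY (degree r))
    (coefficientSpace_le_coeff_ofSymbols 𝓜.mhs Y hY (degree r) hmem)

/-- The same with the degree cast along `ℕ → WithBot (WithTop ℤ)`. [folklore] -/
theorem hodgeColevel_noriSymbol_le_degree' (Ψ : NoriSymbolData R B σ)
    (𝓜 : MixedHodgeStructureOfPair k) (r : IntegralRep n) :
    (HodgePeriodDatum.ofSymbols R B σ 𝓜.mhs).hodgeColevel (noriSymbol Ψ (of r)) ≤
      (degree r : WithBot (WithTop ℤ)) := by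
  have h := hodgeColevel_noriSymbol_le_degree Ψ 𝓜 r
  have e : (((degree r : ℤ) : WithTop ℤ) : WithBot (WithTop ℤ)) = (degree r : WithBot (WithTop ℤ)) := by
    norm_cast
  rwa [e] at h

/-- Hence, with Deligne-bound Hodge data, the repaired typed `DegreeEquality` is EQUIVALENT to
its upper-bound half off the zero symbol. [folklore] -/
theorem repairedReading_iff_upperBound (Ψ : NoriSymbolData R B σ) (𝓜 : MixedHodgeStructureOfPair k) :
    (∀ ⦃n : ℕ⦄ (r : IntegralRep n), noriSymbol Ψ (of r) ≠ 0 →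
        (degree r : WithBot (WithTop ℤ)) =
          (HodgePeriodDatum.ofSymbols R B σ 𝓜.mhs).hodgeColevel (noriSymbol Ψ (of r))) ↔
      ∀ ⦃n : ℕ⦄ (r : IntegralRep n), noriSymbol Ψ (of r) ≠ 0 →
        (degree r : WithBot (WithTop ℤ)) ≤
          (HodgePeriodDatum.ofSymbols R B σ 𝓜.mhs).hodgeColevel (noriSymbol Ψ (of r)) :=
  ⟨fun h _ r hr => (h r hr).le,
    fun h _ r hr => le_antisymm (h r hr) (hodgeColevel_noriSymbol_le_degree' Ψ 𝓜 r)⟩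

end PairHodgeData

end Summit.KontsevichZagierPeriods.Theorems.DegreeEquality.Negative

end
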